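import Mathlib
import HarnessLib
import Summits.Ventures.LatticeQCDFlow.Scoring.ChainEDFBand
import Summits.Ventures.LatticeQCDFlow.Scoring.SampleQuantileConsistency

/-!
# GLIVENKO–CANTELLI ALONG A DOEBLIN CHAIN, FROM ANY START: almost surely the empirical
# distribution function of a real statistic of the chain converges UNIFORMLY to its stationary
# distribution function, and every identifiable sample quantile (median, percentiles) converges

HONEST FRAMING: exact (Metropolis-corrected) sampling algorithms for lattice gauge theory;
figures of merit are autocorrelation/cost numbers at stated couplings and volumes; no
continuum-physics claim.

Venture `LatticeQCDFlow` (cell pub-lqcd), topic `Scoring`; FANOUT row 4 (`s0-u1-b`, rung S0-B).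
Row 4's `Scoring/GlivenkoCantelli` (the classical theorem, iid) and
`Scoring/SampleQuantileConsistency` (medians/percentiles, iid) describe a card computed from
INDEPENDENT draws; the output of an exact sampler is a Markov chain.  From the finite-`N` uniform
band along a Doeblin chain (`Scoring/ChainEDFBand.chain_measureReal_exists_edf_dev_ge_le_of_pos`:
failure probability `2(⌈2/η⌉ + 1)·exp(−(Nη − 16/ε)²/(128N/ε²))`, any start) and the first
Borel–Cantelli lemma (the bound is eventually `≤ C·e^{−Nη²ε²/512}`, summable in `N`):
**`chain_glivenkoCantelli_ae`** — for the simulated chain (Mathlib's `Kernel.trajMeasure`, ANY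
initial law) of a Markov kernel `κ` with invariant law `π` and `κ(x, ·) ≥ ε π`, and any measurable
real statistic `O`, almost surely `sup_t |#{i<N : O(X_i) ≤ t}/N − F_π(t)| → 0`
(`F_π = cdf (π ∘ O⁻¹)`, atoms allowed); **`chain_sampleQuantile_tendsto_ae`** — hence, by the
deterministic `SampleQuantileConsistency.tendsto_sampleQuantile_of_tendstoUniformly`, every sample
quantile of the chain output at an identifiable level converges almost surely to the population
quantile; **`indepMH_glivenkoCantelli_ae`** — the exact flow sampler `indepMH q w` under a
weight ceiling `w ≤ M`.  No stationarity, no independence, no moment hypothesis.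
NEW WORK of the cell (not a published result); no definition is introduced.

## Content

* `measureReal_le_geometric_of_band` — the band's failure probability is below a geometric
  sequence, uniformly in `N`; `ae_eventually_forall_abs_lt` — Borel–Cantelli at one accuracy;
* **`chain_glivenkoCantelli_ae`**, **`chain_sampleQuantile_tendsto_ae`**,
  **`indepMH_glivenkoCantelli_ae`**.

NOT CLAIMED: a rate for the almost-sure statement (the finite-`N` band is the rate statement);
any `ε` for a concrete sampler; non-identifiable quantile levels; the reweighted curve of a
proposal stream.
-/

noncomputable section

namespace Summit.Ventures.LatticeQCDFlow.Scoring.GlivenkoCantelli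

open MeasureTheory ProbabilityTheory Finset Filter Function
open scoped Topology ENNReal

variable {Ω : Type*} [MeasurableSpace Ω]
variable {κ : Kernel Ω Ω} [IsMarkovKernel κ] {μ₀ : Measure Ω} [IsProbabilityMeasure μ₀]
  {π : Measure Ω} [IsProbabilityMeasure π]

/-! ## §1 A geometric majorant and Borel–Cantelli at one accuracy -/

section BorelCantelli

/-- **The band's failure probability lies below a geometric sequence, for every `N`.**  With
`e = ε.toReal > 0`, `c = η²e²/512`, `N₀ = ⌈32/(eη)⌉` and `C = 2(⌈2/η⌉ + 1)`:
`P_{μ₀}(∃ t, η ≤ |F_π(t) − F̂_N(t)|) ≤ (C + e^{cN₀})·e^{−cN}` for EVERY `N` (for `Nη ≥ 32/e` from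
the band, since then `(Nη − 16/e)² ≥ N²η²/4`; below, the probability is at most `1 ≤ e^{c(N₀−N)}`).
[ours] -/
theorem measureReal_le_geometric_of_band (hπ : Kernel.Invariant κ π) {ε : ℝ≥0∞}
    (hmin : ∀ x {B : Set Ω}, MeasurableSet B → ε * π B ≤ κ x B) (hε0 : 0 < ε)
    {O : Ω → ℝ} (hO : Measurable O) {η : ℝ} (hη : 0 < η) (N : ℕ) :
    (Kernel.trajMeasure (X := fun _ : ℕ => Ω) μ₀
          (fun m : ℕ => κ.comap (fun y : (i : ↥(Finset.Iic m)) → Ω => y ⟨m, Finset.mem_Iic.2 le_rfl⟩)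
            (measurable_pi_apply _))).real
        {x | ∃ t : ℝ, η ≤ |cdf (π.map O) t
            - (∑ i ∈ range N, (Set.Iic t).indicator (1 : ℝ → ℝ) (O (x i))) / N|}
      ≤ (2 * ((⌈2 / η⌉₊ : ℝ) + 1)
            + Real.exp (η ^ 2 * ε.toReal ^ 2 / 512 * ⌈32 / (ε.toReal * η)⌉₊))
          * Real.exp (N * (-(η ^ 2 * ε.toReal ^ 2 / 512))) := by
  set P := Kernel.trajMeasure (X := fun _ : ℕ => Ω) μ₀
      (fun m : ℕ => κ.comap (fun y : (i : ↥(Finset.Iic m)) → Ω => y ⟨m, Finset.mem_Iic.2 le_rfl⟩)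
        (measurable_pi_apply _)) with hP
  obtain ⟨-, -, -, -, -, he⟩ := half_const_bounds hmin hε0
  set e : ℝ := ε.toReal with hedef
  set c : ℝ := η ^ 2 * e ^ 2 / 512 with hc
  set C : ℝ := 2 * ((⌈2 / η⌉₊ : ℝ) + 1) with hC
  set N₀ : ℕ := ⌈32 / (e * η)⌉₊ with hN₀
  have hc0 : 0 < c := by positivity
  have hC0 : 0 ≤ C := by positivity
  have hexpN : Real.exp (N * (-c)) = Real.exp (-(c * N)) := by ring_nf
  by_cases hlarge : 32 / e ≤ N * η
  · -- from the band
    have hN : N ≠ 0 := by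
      rintro rfl
      have : (0 : ℝ) < 32 / e := by positivity
      simp at hlarge
      linarith
    have hNη : 16 / e ≤ N * η := le_trans (by rw [div_le_div_iff_of_pos_right he]; norm_num) hlarge
    have hband := chain_measureReal_exists_edf_dev_ge_le_of_pos (μ₀ := μ₀) hπ hmin hε0 hO hN hη hNη
    rw [← hP] at hband
    have hNpos : (0 : ℝ) < N := by exact_mod_cast Nat.pos_of_ne_zero hN
    -- the exponent comparison `(Nη − 16/e)²/(128N/e²) ≥ cN`
    have hexp_le : Real.exp (-(N * η - 16 / e) ^ 2 / (128 * N / e ^ 2))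
        ≤ Real.exp (N * (-c)) := by
      refine Real.exp_le_exp.2 ?_
      have hden : (0 : ℝ) < 128 * N / e ^ 2 := by positivity
      have hhalf : N * η / 2 ≤ N * η - 16 / e := by
        have : (32 : ℝ) / e = 2 * (16 / e) := by ring
        linarith
      have hsq : (N * η / 2) ^ 2 ≤ (N * η - 16 / e) ^ 2 :=
        pow_le_pow_left₀ (by positivity) hhalf 2
      have hkey : c * N * (128 * N / e ^ 2) = (N * η / 2) ^ 2 := by
        rw [hc]
        field_simp
        ring
      rw [neg_div, mul_neg, neg_le_neg_iff, le_div_iff₀ hden, mul_comm (N : ℝ) c, hkey]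
      exact hsq
    calc P.real {x | ∃ t : ℝ, η ≤ |cdf (π.map O) t
            - (∑ i ∈ range N, (Set.Iic t).indicator (1 : ℝ → ℝ) (O (x i))) / N|}
        ≤ C * Real.exp (-(N * η - 16 / e) ^ 2 / (128 * N / e ^ 2)) := hband
      _ ≤ C * Real.exp (N * (-c)) := mul_le_mul_of_nonneg_left hexp_le hC0
      _ ≤ (C + Real.exp (c * N₀)) * Real.exp (N * (-c)) := by
          have : 0 ≤ Real.exp (c * N₀) * Real.exp (N * (-c)) := by positivity
          nlinarith [Real.exp_pos (N * (-c))]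
  · -- trivially, below the threshold
    have hNlt : (N : ℝ) < N₀ := by
      have h1 : (N : ℝ) * η < 32 / e := not_le.1 hlarge
      have h2 : (N : ℝ) < 32 / (e * η) := by
        rw [lt_div_iff₀ (by positivity)]
        calc (N : ℝ) * (e * η) = N * η * e := by ring
          _ < 32 / e * e := mul_lt_mul_of_pos_right h1 he
          _ = 32 := by field_simp
      exact lt_of_lt_of_le h2 (Nat.le_ceil _)
    have hone : (1 : ℝ) ≤ Real.exp (c * N₀) * Real.exp (N * (-c)) := by
      rw [← Real.exp_add]
      exact Real.one_le_exp_iff.2 (by nlinarith) |>.trans le_rfl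
    calc P.real {x | ∃ t : ℝ, η ≤ |cdf (π.map O) t
            - (∑ i ∈ range N, (Set.Iic t).indicator (1 : ℝ → ℝ) (O (x i))) / N|}
        ≤ 1 := measureReal_le_one
      _ ≤ Real.exp (c * N₀) * Real.exp (N * (-c)) := hone
      _ ≤ (C + Real.exp (c * N₀)) * Real.exp (N * (-c)) := by
          have : 0 ≤ C * Real.exp (N * (-c)) := by positivity
          nlinarith

/-- **Borel–Cantelli at one accuracy**: from any start, almost surely, for all large `N`, the
empirical distribution function of the first `N` states is within `η` of `F_π` at EVERY `t`.
[ours] -/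
theorem ae_eventually_forall_abs_lt (hπ : Kernel.Invariant κ π) {ε : ℝ≥0∞}
    (hmin : ∀ x {B : Set Ω}, MeasurableSet B → ε * π B ≤ κ x B) (hε0 : 0 < ε)
    {O : Ω → ℝ} (hO : Measurable O) {η : ℝ} (hη : 0 < η) :
    ∀ᵐ x ∂(Kernel.trajMeasure (X := fun _ : ℕ => Ω) μ₀
          (fun m : ℕ => κ.comap (fun y : (i : ↥(Finset.Iic m)) → Ω => y ⟨m, Finset.mem_Iic.2 le_rfl⟩)
            (measurable_pi_apply _))),
      ∀ᶠ N : ℕ in atTop, ∀ t : ℝ, |cdf (π.map O) t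
          - (∑ i ∈ range N, (Set.Iic t).indicator (1 : ℝ → ℝ) (O (x i))) / N| < η := by
  set P := Kernel.trajMeasure (X := fun _ : ℕ => Ω) μ₀
      (fun m : ℕ => κ.comap (fun y : (i : ↥(Finset.Iic m)) → Ω => y ⟨m, Finset.mem_Iic.2 le_rfl⟩)
        (measurable_pi_apply _)) with hP
  obtain ⟨-, -, -, -, -, he⟩ := half_const_bounds hmin hε0
  set E : ℕ → Set (ℕ → Ω) := fun N => {x | ∃ t : ℝ, η ≤ |cdf (π.map O) t
    - (∑ i ∈ range N, (Set.Iic t).indicator (1 : ℝ → ℝ) (O (x i))) / N|} with hE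
  set a : ℕ → ℝ := fun N => (2 * ((⌈2 / η⌉₊ : ℝ) + 1)
      + Real.exp (η ^ 2 * ε.toReal ^ 2 / 512 * ⌈32 / (ε.toReal * η)⌉₊))
    * Real.exp (N * (-(η ^ 2 * ε.toReal ^ 2 / 512))) with ha
  have ha0 : ∀ N, 0 ≤ a N := fun N => by positivity
  have hsum : Summable a :=
    (Real.summable_exp_nat_mul_iff.2 (by
      have : 0 < η ^ 2 * ε.toReal ^ 2 / 512 := by positivity
      linarith)).mul_left _
  have hle : ∀ N, P.real (E N) ≤ a N := fun N =>
    measureReal_le_geometric_of_band (μ₀ := μ₀) hπ hmin hε0 hO hη N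
  -- first Borel–Cantelli with real bounds
  have h1 : ∀ N, P (E N) ≤ ENNReal.ofReal (a N) := fun N =>
    (ENNReal.le_ofReal_iff_toReal_le (measure_ne_top P _) (ha0 N)).2 (hle N)
  have h2 : ∑' N, P (E N) ≠ ∞ := by
    refine ne_top_of_le_ne_top ?_ (ENNReal.tsum_le_tsum h1)
    rw [← ENNReal.ofReal_tsum_of_nonneg ha0 hsum]
    exact ENNReal.ofReal_ne_top
  filter_upwards [ae_eventually_notMem h2] with x hx
  filter_upwards [hx] with N hN t
  by_contra hge
  exact hN ⟨t, not_lt.1 hge⟩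

end BorelCantelli

/-! ## §2 Glivenko–Cantelli along the chain and the sample quantiles -/

section GlivenkoCantelli

/-- **GLIVENKO–CANTELLI ALONG A DOEBLIN CHAIN, FROM ANY START.**  `π` invariant for `κ`,
`κ(x, ·) ≥ ε π` (`ε > 0`), `O` a measurable real statistic, `F_π = cdf (π ∘ O⁻¹)` (atoms allowed).
Then for every initial law `μ₀`, `P_{μ₀}`-almost surely the empirical distribution functions
`t ↦ #{i<N : O(X_i) ≤ t}/N` converge to `F_π` UNIFORMLY on `ℝ`. [ours] (Borel–Cantelli at the
accuracies `1/(m+1)`) -/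
theorem chain_glivenkoCantelli_ae (hπ : Kernel.Invariant κ π) {ε : ℝ≥0∞}
    (hmin : ∀ x {B : Set Ω}, MeasurableSet B → ε * π B ≤ κ x B) (hε0 : 0 < ε)
    {O : Ω → ℝ} (hO : Measurable O) :
    ∀ᵐ x ∂(Kernel.trajMeasure (X := fun _ : ℕ => Ω) μ₀
          (fun m : ℕ => κ.comap (fun y : (i : ↥(Finset.Iic m)) → Ω => y ⟨m, Finset.mem_Iic.2 le_rfl⟩)
            (measurable_pi_apply _))),
      TendstoUniformly (fun (N : ℕ) (t : ℝ) =>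
          (∑ i ∈ range N, (Set.Iic t).indicator (1 : ℝ → ℝ) (O (x i))) / N)
        (cdf (π.map O)) atTop := by
  have hall := ae_all_iff.2 fun m : ℕ =>
    ae_eventually_forall_abs_lt (μ₀ := μ₀) hπ hmin hε0 hO (η := 1 / ((m : ℝ) + 1))
      (by positivity)
  filter_upwards [hall] with x hx
  rw [Metric.tendstoUniformly_iff]
  intro δ hδ
  obtain ⟨m, hm⟩ := exists_nat_one_div_lt hδ
  filter_upwards [hx m] with N hN t
  rw [Real.dist_eq]
  exact (hN t).trans hm

/-- **Sample quantiles of the chain output are strongly consistent at identifiable levels, from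
any start.**  Same setting; `u ∈ (0,1)` with `F_π(q_π(u) + δ) > u` for every `δ > 0`
(`q_π(u) = inf{x : u ≤ F_π(x)}`).  Then `P_{μ₀}`-almost surely the empirical `u`-quantile of the
first `N` states, `inf{x : u ≤ #{i<N : O(X_i) ≤ x}/N}` (the running median for `u = ½`), tends to
`q_π(u)`. [ours] (`chain_glivenkoCantelli_ae` and the deterministic
`tendsto_sampleQuantile_of_tendstoUniformly`) -/
theorem chain_sampleQuantile_tendsto_ae (hπ : Kernel.Invariant κ π) {ε : ℝ≥0∞}
    (hmin : ∀ x {B : Set Ω}, MeasurableSet B → ε * π B ≤ κ x B) (hε0 : 0 < ε)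
    {O : Ω → ℝ} (hO : Measurable O) {u : ℝ} (hu0 : 0 < u) (hu1 : u < 1)
    (hid : ∀ δ, 0 < δ → u < cdf (π.map O) (sInf {x | u ≤ cdf (π.map O) x} + δ)) :
    ∀ᵐ x ∂(Kernel.trajMeasure (X := fun _ : ℕ => Ω) μ₀
          (fun m : ℕ => κ.comap (fun y : (i : ↥(Finset.Iic m)) → Ω => y ⟨m, Finset.mem_Iic.2 le_rfl⟩)
            (measurable_pi_apply _))),
      Tendsto (fun N : ℕ =>
          sInf {y | u ≤ (∑ i ∈ range N, (Set.Iic y).indicator (1 : ℝ → ℝ) (O (x i))) / N}) atTop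
        (𝓝 (sInf {y | u ≤ cdf (π.map O) y})) := by
  filter_upwards [chain_glivenkoCantelli_ae (μ₀ := μ₀) hπ hmin hε0 hO] with x hx
  have hmono : ∀ N : ℕ, Monotone fun y : ℝ =>
      (∑ i ∈ range N, (Set.Iic y).indicator (1 : ℝ → ℝ) (O (x i))) / (N : ℝ) := fun N s t hst =>
    div_le_div_of_nonneg_right (sum_le_sum fun i _ => indicator_Iic_mono _ hst) (Nat.cast_nonneg N)
  exact tendsto_sampleQuantile_of_tendstoUniformly (π.map O) hmono hx hu0 hu1 hid

end GlivenkoCantelli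

/-! ## §3 The exact flow sampler under a weight ceiling -/

section FlowSampler

open Summit.Ventures.LatticeQCDFlow.Exactness

/-- **GLIVENKO–CANTELLI FOR THE EXACT FLOW SAMPLER, FROM ANY START.**  Model law `q`, weight
`w = dπ/dq` measurable with `0 < w ≤ M`, `π = w · q` a probability law, `K = indepMH q w` (exact
for `π`, Doeblin with `ε = 1/M`).  For every measurable real observable `O` and every initial law,
almost surely the printed distribution function of `O` over the first `N` states converges
uniformly to `cdf (π ∘ O⁻¹)`. [ours] -/
theorem indepMH_glivenkoCantelli_ae {q : Measure Ω} [IsProbabilityMeasure q] {w : Ω → ℝ}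
    [hwF : Fact (Measurable w)] (hw0 : ∀ x, 0 < w x) {M : ℝ} (hM : ∀ x, w x ≤ M)
    [IsProbabilityMeasure (q.withDensity fun y => ENNReal.ofReal (w y))]
    {O : Ω → ℝ} (hO : Measurable O) :
    ∀ᵐ x ∂(Kernel.trajMeasure (X := fun _ : ℕ => Ω) μ₀
          (fun m : ℕ => (indepMH q w).comap
            (fun y : (i : ↥(Finset.Iic m)) → Ω => y ⟨m, Finset.mem_Iic.2 le_rfl⟩)
            (measurable_pi_apply _))),
      TendstoUniformly (fun (N : ℕ) (t : ℝ) =>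
          (∑ i ∈ range N, (Set.Iic t).indicator (1 : ℝ → ℝ) (O (x i))) / N)
        (cdf ((q.withDensity fun y => ENNReal.ofReal (w y)).map O)) atTop := by
  have hw : Measurable w := hwF.out
  have hinv := indepMH_invariant (q := q) hw hw0
  have hmin : ∀ x {B : Set Ω}, MeasurableSet B →
      (ENNReal.ofReal M)⁻¹ * (q.withDensity fun y => ENNReal.ofReal (w y)) B ≤ indepMH q w x B :=
    fun x B hB => indepMH_apply_ge (q := q) hw hw0 hM x hB
  have hε0 : 0 < (ENNReal.ofReal M)⁻¹ := ENNReal.inv_pos.2 ENNReal.ofReal_ne_top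
  exact chain_glivenkoCantelli_ae (μ₀ := μ₀) hinv hmin hε0 hO

end FlowSampler

end Summit.Ventures.LatticeQCDFlow.Scoring.GlivenkoCantelli

end
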